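import Mathlib
import Summits.KontsevichZagierPeriods.Zeta5Search.GHatSecondOrder
import Summits.KontsevichZagierPeriods.Zeta5Search.SecondOrderAssembly
import HarnessLib

/-!
# ζ(5) search — `p`-adic Taylor expansion of integer powers and finite products TO THIRD ORDER (tools for gen-2 g10's third-digit lemma)

Cell `pub-zeta5` (HONEST FRAMING: systematic search; no irrationality claim unless certified), typer seat generation 12.
Generic `p`-adic estimates (rational numbers, `padicNorm`) used by the third-order class invariants of `GHatThirdOrder.lean`
(REPORT-gen2-g10 §6.2, `Ĝ_x(η) ≡ 1 − pφη + p²cη² (mod p³)`):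
* `padicNorm_zpow_add_sub_le₃` — `(u + t)^e ≡ u^e (1 + e t/u + e(e−1)/2 · t²/u²) (mod p³)` for a unit `u`, `‖t‖ ≤ p⁻¹`, ALL `e ∈ ℤ`
  (two-sided induction on `e` through the exact step identity `D(e+1) = (u+t)D(e) + u^{e+1}·e(e−1)/2·(t/u)³`);
* `padicNorm_prod_zpow_add_sub_le₃` — product form: `∏ (u_i + t)^{e_i} ≡ (∏ u_i^{e_i})(1 + t s₁ + t²(s₁² − s₂)/2) (mod p³)`,
  `s₁ = Σ e_i/u_i`, `s₂ = Σ e_i/u_i²` (`p` odd);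
* one-term expansions `padicNorm_div_sq_sub_le` (`e/(u+t)² ≡ e/u² mod p`) and `padicNorm_div_add_sub_le` (`e/(u+t) ≡ e/u − te/u² mod p²`).
Nothing here concerns irrationality.
-/

noncomputable section

open Finset

namespace Summit.KontsevichZagierPeriods.Zeta5Search.SecondOrder

open Summit.KontsevichZagierPeriods.Zeta5Search.PadicSeries
open Summit.KontsevichZagierPeriods.Zeta5Search.CellA (padicNorm_zpow_unit padicNorm_pow_eq padicNorm_inv' padicNorm_prod_le_one padicNorm_p)

variable {p : ℕ} [hp : Fact p.Prime]

/-! ### Small `p`-adic tools -/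

/-- `‖t^3‖ ≤ p^{-3}` when `‖t‖ ≤ p⁻¹`. -/
theorem padicNorm_cube_le {t : ℚ} (ht : padicNorm p t ≤ (p : ℚ) ^ (-(1 : ℤ))) : padicNorm p (t ^ 3) ≤ (p : ℚ) ^ (-(3 : ℤ)) := by
  rw [padicNorm_pow_eq]
  calc padicNorm p t ^ 3 ≤ ((p : ℚ) ^ (-(1 : ℤ))) ^ 3 := pow_le_pow_left₀ (padicNorm.nonneg _) ht 3
    _ = (p : ℚ) ^ (-(3 : ℤ)) := by rw [← zpow_natCast, ← zpow_mul]; norm_num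

/-- `‖t^2‖ ≤ p^{-2}` when `‖t‖ ≤ p⁻¹`. -/
theorem padicNorm_sq_le {t : ℚ} (ht : padicNorm p t ≤ (p : ℚ) ^ (-(1 : ℤ))) : padicNorm p (t ^ 2) ≤ (p : ℚ) ^ (-(2 : ℤ)) := by
  rw [padicNorm_pow_eq]
  calc padicNorm p t ^ 2 ≤ ((p : ℚ) ^ (-(1 : ℤ))) ^ 2 := pow_le_pow_left₀ (padicNorm.nonneg _) ht 2
    _ = (p : ℚ) ^ (-(2 : ℤ)) := by rw [← zpow_natCast, ← zpow_mul]; norm_num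

/-- A unit plus a small element is a unit. -/
theorem padicNorm_add_small_eq_one {u t : ℚ} (hu : padicNorm p u = 1) (ht : padicNorm p t ≤ (p : ℚ) ^ (-(1 : ℤ))) :
    padicNorm p (u + t) = 1 := by
  have hu0 : u ≠ 0 := fun h => by rw [h, padicNorm.zero] at hu; exact zero_ne_one hu
  have e1 : u + t = u * (1 + t / u) := by field_simp
  rw [e1, padicNorm.mul, hu, one_mul]
  exact padicNorm_one_add_eq_one (by rw [padicNorm.div, hu, div_one]; exact ht)

/-- `‖a · b · t³‖ ≤ p⁻³` for `p`-integral `a, b` and `‖t‖ ≤ p⁻¹`. -/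
theorem padicNorm_mul_mul_cube_le {a b t : ℚ} (ha : padicNorm p a ≤ 1) (hb : padicNorm p b ≤ 1)
    (ht : padicNorm p t ≤ (p : ℚ) ^ (-(1 : ℤ))) : padicNorm p (a * b * t ^ 3) ≤ (p : ℚ) ^ (-(3 : ℤ)) := by
  rw [padicNorm.mul, padicNorm.mul]
  calc padicNorm p a * padicNorm p b * padicNorm p (t ^ 3) ≤ 1 * 1 * (p : ℚ) ^ (-(3 : ℤ)) :=
        mul_le_mul (mul_le_mul ha hb (padicNorm.nonneg _) zero_le_one) (padicNorm_cube_le ht) (padicNorm.nonneg _)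
          (by positivity)
    _ = _ := by ring

/-! ### One factor to third order: `(u + t)^e ≡ u^e (1 + e t/u + e(e−1)/2 · t²/u²) (mod p³)` -/

/-- **Integer powers to third order** for a unit `u` and `‖t‖ ≤ p⁻¹` (`p` odd). -/
theorem padicNorm_zpow_add_sub_le₃ (hp2 : p ≠ 2) {u t : ℚ} (hu : padicNorm p u = 1) (ht : padicNorm p t ≤ (p : ℚ) ^ (-(1 : ℤ)))
    (e : ℤ) :
    padicNorm p ((u + t) ^ e - u ^ e * (1 + (e : ℚ) * t / u + (e : ℚ) * (e - 1) / 2 * (t / u) ^ 2)) ≤ (p : ℚ) ^ (-(3 : ℤ)) := by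
  have hu0 : u ≠ 0 := fun h => by rw [h, padicNorm.zero] at hu; exact zero_ne_one hu
  have hut1 : padicNorm p (u + t) = 1 := padicNorm_add_small_eq_one hu ht
  have hut0 : u + t ≠ 0 := fun h => by rw [h, padicNorm.zero] at hut1; exact zero_ne_one hut1
  have h2 := padicNorm_two (p := p) hp2
  have htu : padicNorm p (t / u) ≤ (p : ℚ) ^ (-(1 : ℤ)) := by rw [padicNorm.div, hu, div_one]; exact ht
  -- the inhomogeneity of the step identity is `O(p³)` for every `e`
  have hinh : ∀ e : ℤ, padicNorm p (u ^ (e + 1) * ((e : ℚ) * (e - 1) / 2) * (t / u) ^ 3) ≤ (p : ℚ) ^ (-(3 : ℤ)) := by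
    intro e
    refine padicNorm_mul_mul_cube_le (padicNorm_zpow_unit hu _).le ?_ htu
    rw [padicNorm.div, h2, div_one, padicNorm.mul]
    have h1 : padicNorm p ((e : ℚ) - 1) ≤ 1 := by
      have : ((e : ℚ) - 1) = (((e - 1 : ℤ)) : ℚ) := by push_cast; ring
      rw [this]; exact padicNorm.of_int _
    calc padicNorm p (e : ℚ) * padicNorm p ((e : ℚ) - 1) ≤ 1 * 1 :=
          mul_le_mul (padicNorm.of_int _) h1 (padicNorm.nonneg _) zero_le_one
      _ = 1 := one_mul 1
  -- the second-order Taylor defect and its exact step identity `D(e+1) = (u+t)·D(e) + u^{e+1}·e(e−1)/2·(t/u)³`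
  set D : ℤ → ℚ := fun e => (u + t) ^ e - u ^ e * (1 + (e : ℚ) * t / u + (e : ℚ) * (e - 1) / 2 * (t / u) ^ 2) with hD
  have hstep : ∀ e : ℤ, D (e + 1) = (u + t) * D e + u ^ (e + 1) * ((e : ℚ) * (e - 1) / 2) * (t / u) ^ 3 := by
    intro e
    simp only [hD]
    rw [zpow_add_one₀ hut0, zpow_add_one₀ hu0]
    push_cast
    field_simp
    ring
  -- two-sided induction on `e`
  change padicNorm p (D e) ≤ (p : ℚ) ^ (-(3 : ℤ))
  induction e using Int.induction_on with
  | zero =>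
    simp only [hD, zpow_zero, Int.cast_zero, zero_mul, zero_div, add_zero, mul_one, sub_self, padicNorm.zero]
    exact zpow_p_nonneg _
  | succ n ih =>
    rw [hstep]
    refine (padicNorm.nonarchimedean (p := p)).trans (max_le ?_ (hinh _))
    rw [padicNorm.mul, hut1, one_mul]; exact ih
  | pred n ih =>
    -- downward step: `D(e) = (u+t)⁻¹ (D(e+1) − inh(e))` with `e = −n − 1`
    have hstep' := hstep (-(n : ℤ) - 1)
    rw [show (-(n : ℤ) - 1 + 1) = -(n : ℤ) by ring] at hstep'
    have e1 : D (-(n : ℤ) - 1) =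
        (u + t)⁻¹ * (D (-(n : ℤ)) - u ^ (-(n : ℤ)) * (((-(n : ℤ) - 1 : ℤ) : ℚ) * ((-(n : ℤ) - 1 : ℤ) - 1) / 2)
          * (t / u) ^ 3) := by
      rw [hstep']; field_simp; ring
    rw [e1, padicNorm.mul, padicNorm_inv', hut1, inv_one, one_mul]
    refine (padicNorm.sub (p := p)).trans (max_le ih ?_)
    have := hinh (-(n : ℤ) - 1)
    rw [show (-(n : ℤ) - 1 + 1) = -(n : ℤ) by ring] at this
    exact this

/-! ### Finite products to third order -/

/-- **`∏ (u_i + t)^{e_i} ≡ (∏ u_i^{e_i}) · (1 + t s₁ + t² (s₁² − s₂)/2) (mod p³)`**, `s₁ = Σ e_i/u_i`, `s₂ = Σ e_i/u_i²`,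
for units `u_i` and `‖t‖ ≤ p⁻¹` (`p` odd). -/
theorem padicNorm_prod_zpow_add_sub_le₃ (hp2 : p ≠ 2) {ι : Type*} (s : Finset ι) (u : ι → ℚ) (e : ι → ℤ) {t : ℚ}
    (hu : ∀ i ∈ s, padicNorm p (u i) = 1) (ht : padicNorm p t ≤ (p : ℚ) ^ (-(1 : ℤ))) :
    padicNorm p (∏ i ∈ s, (u i + t) ^ e i - (∏ i ∈ s, u i ^ e i) *
      (1 + t * ∑ i ∈ s, (e i : ℚ) / u i
        + t ^ 2 * (((∑ i ∈ s, (e i : ℚ) / u i) ^ 2 - ∑ i ∈ s, (e i : ℚ) / u i ^ 2) / 2))) ≤ (p : ℚ) ^ (-(3 : ℤ)) := by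
  classical
  have h2 := padicNorm_two (p := p) hp2
  have ht1 : padicNorm p t ≤ 1 := ht.trans (zpow_le_one_of_nonpos₀ one_le_p (by norm_num))
  induction s using Finset.induction_on with
  | empty =>
    simp only [prod_empty, sum_empty, mul_zero, add_zero, one_mul]
    rw [show (1 : ℚ) - (1 + t ^ 2 * ((0 ^ 2 - 0) / 2)) = 0 by ring, padicNorm.zero]; exact zpow_p_nonneg _
  | insert a s ha ih =>
    have hua : padicNorm p (u a) = 1 := hu a (mem_insert_self a s)
    have hua0 : u a ≠ 0 := fun h => by rw [h, padicNorm.zero] at hua; exact zero_ne_one hua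
    have hus : ∀ i ∈ s, padicNorm p (u i) = 1 := fun i hi => hu i (mem_insert_of_mem hi)
    have ih' := ih hus
    -- abbreviations
    set P := ∏ i ∈ s, u i ^ e i with hP
    set S₁ := ∑ i ∈ s, (e i : ℚ) / u i with hS₁
    set S₂ := ∑ i ∈ s, (e i : ℚ) / u i ^ 2 with hS₂
    set α : ℚ := (e a : ℚ) / u a with hα
    set β : ℚ := (e a : ℚ) * (e a - 1) / 2 / u a ^ 2 with hβ
    set γ : ℚ := (S₁ ^ 2 - S₂) / 2 with hγ
    -- norms of the pieces
    have hFa : padicNorm p ((u a + t) ^ e a) ≤ 1 := (padicNorm_zpow_unit (padicNorm_add_small_eq_one hua ht) _).le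
    have hPn : padicNorm p P ≤ 1 := padicNorm_prod_le_one s _ fun i hi => (padicNorm_zpow_unit (hus i hi) _).le
    have hS₁n : padicNorm p S₁ ≤ 1 := by
      refine padicNorm.sum_le' (fun i hi => ?_) zero_le_one
      rw [padicNorm.div, hus i hi, div_one]; exact padicNorm.of_int _
    have hS₂n : padicNorm p S₂ ≤ 1 := by
      refine padicNorm.sum_le' (fun i hi => ?_) zero_le_one
      rw [padicNorm.div, padicNorm_pow_eq, hus i hi, one_pow, div_one]; exact padicNorm.of_int _
    have hαn : padicNorm p α ≤ 1 := by rw [hα, padicNorm.div, hua, div_one]; exact padicNorm.of_int _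
    have hβn : padicNorm p β ≤ 1 := by
      rw [hβ, padicNorm.div, padicNorm.div, padicNorm_pow_eq, hua, one_pow, div_one, h2, div_one, padicNorm.mul]
      have h1 : padicNorm p ((e a : ℚ) - 1) ≤ 1 := by
        have : ((e a : ℚ) - 1) = (((e a - 1 : ℤ)) : ℚ) := by push_cast; ring
        rw [this]; exact padicNorm.of_int _
      calc padicNorm p (e a : ℚ) * padicNorm p ((e a : ℚ) - 1) ≤ 1 * 1 :=
            mul_le_mul (padicNorm.of_int _) h1 (padicNorm.nonneg _) zero_le_one
        _ = 1 := one_mul 1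
    have hγn : padicNorm p γ ≤ 1 := by
      rw [hγ, padicNorm.div, h2, div_one]
      refine (padicNorm.sub (p := p)).trans (max_le ?_ hS₂n)
      rw [padicNorm_pow_eq]; exact pow_le_one₀ (padicNorm.nonneg _) hS₁n
    have hQ : padicNorm p (1 + t * S₁ + t ^ 2 * γ) ≤ 1 := by
      refine (padicNorm.nonarchimedean (p := p)).trans (max_le ((padicNorm.nonarchimedean (p := p)).trans (max_le ?_ ?_)) ?_)
      · rw [padicNorm.one]
      · rw [padicNorm.mul]
        calc padicNorm p t * padicNorm p S₁ ≤ 1 * 1 := mul_le_mul ht1 hS₁n (padicNorm.nonneg _) zero_le_one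
          _ = 1 := one_mul 1
      · rw [padicNorm.mul, padicNorm_pow_eq]
        calc padicNorm p t ^ 2 * padicNorm p γ ≤ 1 ^ 2 * 1 :=
              mul_le_mul (pow_le_pow_left₀ (padicNorm.nonneg _) ht1 2) hγn (padicNorm.nonneg _) (by positivity)
          _ = 1 := by ring
    have hδa := padicNorm_zpow_add_sub_le₃ hp2 hua ht (e a)
    -- the insertion identity
    rw [prod_insert ha, prod_insert ha, sum_insert ha, sum_insert ha]
    have eI : (u a + t) ^ e a * ∏ i ∈ s, (u i + t) ^ e i -
        (u a ^ e a * P) * (1 + t * (α + S₁) + t ^ 2 * (((α + S₁) ^ 2 - ((e a : ℚ) / u a ^ 2 + S₂)) / 2)) =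
        (u a + t) ^ e a * (∏ i ∈ s, (u i + t) ^ e i - P * (1 + t * S₁ + t ^ 2 * γ))
        + ((u a + t) ^ e a - u a ^ e a * (1 + (e a : ℚ) * t / u a + (e a : ℚ) * (e a - 1) / 2 * (t / u a) ^ 2))
            * (P * (1 + t * S₁ + t ^ 2 * γ))
        + u a ^ e a * P * (α * γ + β * S₁ + β * γ * t) * t ^ 3 := by
      rw [hα, hβ, hγ]
      field_simp
      ring
    rw [eI]
    refine (padicNorm.nonarchimedean (p := p)).trans
      (max_le ((padicNorm.nonarchimedean (p := p)).trans (max_le ?_ ?_)) ?_)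
    · rw [padicNorm.mul]
      calc padicNorm p ((u a + t) ^ e a) * _ ≤ 1 * (p : ℚ) ^ (-(3 : ℤ)) :=
            mul_le_mul hFa ih' (padicNorm.nonneg _) zero_le_one
        _ = _ := one_mul _
    · rw [padicNorm.mul, padicNorm.mul]
      calc _ * (padicNorm p P * _) ≤ (p : ℚ) ^ (-(3 : ℤ)) * (1 * 1) :=
            mul_le_mul hδa (mul_le_mul hPn hQ (padicNorm.nonneg _) zero_le_one)
              (mul_nonneg (padicNorm.nonneg _) (padicNorm.nonneg _)) (zpow_p_nonneg _)
        _ = _ := by ring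
    · have hU : padicNorm p (u a ^ e a * P) ≤ 1 := by
        rw [padicNorm.mul, padicNorm_zpow_unit hua, one_mul]; exact hPn
      have hV : padicNorm p (α * γ + β * S₁ + β * γ * t) ≤ 1 := by
        refine (padicNorm.nonarchimedean (p := p)).trans
          (max_le ((padicNorm.nonarchimedean (p := p)).trans (max_le ?_ ?_)) ?_)
        · rw [padicNorm.mul]
          calc padicNorm p α * padicNorm p γ ≤ 1 * 1 := mul_le_mul hαn hγn (padicNorm.nonneg _) zero_le_one
            _ = 1 := one_mul 1
        · rw [padicNorm.mul]
          calc padicNorm p β * padicNorm p S₁ ≤ 1 * 1 := mul_le_mul hβn hS₁n (padicNorm.nonneg _) zero_le_one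
            _ = 1 := one_mul 1
        · rw [padicNorm.mul, padicNorm.mul]
          calc padicNorm p β * padicNorm p γ * padicNorm p t ≤ 1 * 1 * 1 :=
                mul_le_mul (mul_le_mul hβn hγn (padicNorm.nonneg _) zero_le_one) ht1 (padicNorm.nonneg _) (by positivity)
            _ = 1 := by ring
      exact padicNorm_mul_mul_cube_le hU hV ht

/-! ### One-term expansions -/

/-- One term of `φ₂`: `‖e/(u+t)² − e/u²‖ ≤ p⁻¹` for a unit `u` and small `t`. -/
theorem padicNorm_div_sq_sub_le {e u t : ℚ} (he : padicNorm p e ≤ 1) (hu : padicNorm p u = 1)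
    (ht : padicNorm p t ≤ (p : ℚ) ^ (-(1 : ℤ))) :
    padicNorm p (e / (u + t) ^ 2 - e / u ^ 2) ≤ (p : ℚ) ^ (-(1 : ℤ)) := by
  have hu0 : u ≠ 0 := fun h => by rw [h, padicNorm.zero] at hu; exact zero_ne_one hu
  have hut1 := padicNorm_add_small_eq_one hu ht
  have hut0 : u + t ≠ 0 := fun h => by rw [h, padicNorm.zero] at hut1; exact zero_ne_one hut1
  have ht1 : padicNorm p t ≤ 1 := ht.trans (zpow_le_one_of_nonpos₀ one_le_p (by norm_num))
  have e1 : e / (u + t) ^ 2 - e / u ^ 2 = -(e * (2 * u + t) * t) / ((u + t) ^ 2 * u ^ 2) := by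
    field_simp; ring
  rw [e1, padicNorm.div, padicNorm.mul, padicNorm_pow_eq, padicNorm_pow_eq, hut1, hu, one_pow, mul_one, div_one,
    padicNorm.neg, padicNorm.mul, padicNorm.mul]
  have h2u : padicNorm p (2 * u + t) ≤ 1 := by
    refine (padicNorm.nonarchimedean (p := p)).trans (max_le ?_ ht1)
    rw [padicNorm.mul, hu, mul_one]; simpa using padicNorm.of_nat (p := p) 2
  calc padicNorm p e * padicNorm p (2 * u + t) * padicNorm p t ≤ 1 * 1 * (p : ℚ) ^ (-(1 : ℤ)) :=
        mul_le_mul (mul_le_mul he h2u (padicNorm.nonneg _) zero_le_one) ht (padicNorm.nonneg _) (by positivity)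
    _ = _ := by ring

/-- One term: `‖e/(u+t) − (e/u − t·e/u²)‖ ≤ p⁻²`. -/
theorem padicNorm_div_add_sub_le {e u t : ℚ} (he : padicNorm p e ≤ 1) (hu : padicNorm p u = 1)
    (ht : padicNorm p t ≤ (p : ℚ) ^ (-(1 : ℤ))) :
    padicNorm p (e / (u + t) - (e / u - t * (e / u ^ 2))) ≤ (p : ℚ) ^ (-(2 : ℤ)) := by
  have hu0 : u ≠ 0 := fun h => by rw [h, padicNorm.zero] at hu; exact zero_ne_one hu
  have hut1 := padicNorm_add_small_eq_one hu ht
  have hut0 : u + t ≠ 0 := fun h => by rw [h, padicNorm.zero] at hut1; exact zero_ne_one hut1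
  have e1 : e / (u + t) - (e / u - t * (e / u ^ 2)) = e * t ^ 2 / (u ^ 2 * (u + t)) := by
    field_simp; ring
  rw [e1, padicNorm.div, padicNorm.mul, padicNorm.mul, padicNorm_pow_eq u 2, hu, hut1, one_pow, mul_one, div_one]
  calc padicNorm p e * padicNorm p (t ^ 2) ≤ 1 * (p : ℚ) ^ (-(2 : ℤ)) :=
        mul_le_mul he (padicNorm_sq_le ht) (padicNorm.nonneg _) zero_le_one
    _ = _ := one_mul _

end Summit.KontsevichZagierPeriods.Zeta5Search.SecondOrder

end
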